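import Literature.AlgebraicTopology.FundamentalGroup.CircleAndTorus
import Literature.Geometry.Kaehler.ComplexTorusMeromorphicDegree
import HarnessLib

/-!
# The torus is not simply connected; a space homeomorphic to a torus is not homeomorphic to the
# Riemann sphere

PROOF-ONLY (no definitions).  Two classical consequences of `π₁(T²) ≅ ℤ × ℤ` (Hatcher, Example 1.13,
the tree's `fundamentalGroupTorusEquiv`) and `π₁(S²) = 1` (Hatcher, Prop. 1.14, the tree's
`simplyConnectedSpace_euclideanSphere`), combined through Mathlib's stereographic homeomorphism
`onePointEquivSphereOfFinrankEq : OnePoint ℂ ≃ₜ S²`: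

* `not_simplyConnectedSpace_addCircle_prod` — `ℝ/ℤp × ℝ/ℤq` (`p, q ≠ 0`) is not simply connected;
* `isEmpty_homeomorph_onePoint_complex_of_torus` — a space homeomorphic to `ℝ/ℤ × ℝ/ℤ` admits no
  homeomorphism onto `ℂ ∪ {∞}` (the sphere side is the tree's `RiemannSphere.simplyConnectedSpace`,
  `Literature/Geometry/Kaehler/ComplexTorusMeromorphicDegree`, reused by import).

The last item is the topological input "genus one is not genus zero" of the uniformization of
compact Riemann surfaces of genus one (abc-iut cell, GAP G-L4t12g4-1 `GenusOneUniformization`, the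
classical base of [AbsTopIII] Cor. 2.7 (c)): together with the tree's
`IsAlgebraicCurve.exists_homeomorph_sphere_of_finrank_H1_zero_eq_zero` it forces `dim H¹(𝒪) ≥ 1` on
a compact Riemann surface homeomorphic to a torus.
-/

noncomputable section

namespace Literature.AlgebraicTopology.FundamentalGroup

open _root_.Set _root_.Function _root_.Topology

/-- **The torus is not simply connected** (Hatcher, Example 1.13: `π₁(S¹ × S¹) ≅ ℤ × ℤ ≠ 1`), for
`ℝ/ℤp × ℝ/ℤq` with `p, q ≠ 0`. [cite: HatcherAT2002, Example 1.13 (p. 34)] -/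
theorem not_simplyConnectedSpace_addCircle_prod {p q : ℝ} (hp : p ≠ 0) (hq : q ≠ 0) :
    ¬ SimplyConnectedSpace (AddCircle p × AddCircle q) := by
  intro h
  have hsub : Subsingleton
      (_root_.FundamentalGroup (AddCircle p × AddCircle q) ((0 : AddCircle p), (0 : AddCircle q))) := by
    unfold _root_.FundamentalGroup
    infer_instance
  have e := fundamentalGroupTorusEquiv hp hq (0 : AddCircle p) (0 : AddCircle q)
  have : Subsingleton (Multiplicative (ℤ × ℤ)) := e.symm.injective.subsingleton
  exact absurd (Subsingleton.elim (Multiplicative.ofAdd ((1 : ℤ), (0 : ℤ))) 1) (by decide)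

/-- **A topological torus is not a topological sphere**: if `T ≃ₜ ℝ/ℤ × ℝ/ℤ` then there is no
homeomorphism `T ≃ₜ ℂ ∪ {∞}` (`π₁` is a homeomorphism invariant: `ℤ × ℤ` versus `1`).
[cite: HatcherAT2002, Example 1.13 (p. 34)] -/
theorem isEmpty_homeomorph_onePoint_complex_of_torus {T : Type*} [TopologicalSpace T]
    (e : T ≃ₜ AddCircle (1 : ℝ) × AddCircle (1 : ℝ)) : IsEmpty (T ≃ₜ OnePoint ℂ) := by
  refine ⟨fun f => not_simplyConnectedSpace_addCircle_prod one_ne_zero one_ne_zero ?_⟩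
  haveI := Literature.Geometry.Kaehler.RiemannSphere.simplyConnectedSpace
  exact (e.symm.trans f).toHomotopyEquiv.simplyConnectedSpace_iff.2 inferInstance

end Literature.AlgebraicTopology.FundamentalGroup
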